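import Summits.QuantumFields.BalabanUV.T4Continuum.Support.VariationalTaxiTransport

/-!
# T⁴ programme, spine node NE2 (U1a), lane P2 — SUPPORT: TAXI CONTOUR TRANSPORTS vs THE STRAIGHT COARSE TRANSPORT (U(1)) — the FACE
# binder `hcross` of leaf ONE⁺ and the MISMATCH binder `hmis` of leaf FED⁺ DERIVED from the plaquette defect alone

NE2 formalisation swarm `b2b-balaban-t4-ne2-formalise-*`, leaf 04 GEN 2 (`prover-b2b-balaban-t4-ne2-formalise-leaf-04-g2-0`); sequel of
`VariationalTaxiTransport` (journal INTENT CLAIMS.log l.9212), which defines the taxi site transports `taxiT R` from unit bond phases `R` on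
the fine torus and proves the IN-BLOCK binder (`hw` of UB⁺ ∕ `hin` of ONE⁺) `≤ (d−1)(L−1)·a` from the plaquette defect `‖plaq − 1‖ ≤ a`.
The P2 leaves carry two more transport data, both comparing fine transports with a COARSE bond phase `Rc : Tor N → Fin d → ℂ`:
 * ONE⁺ (`VariationalCovariantOneStep.exists_oneStep_lattice`, leaf-01-g2) binder `hcross`: on a bond LEAVING block `y` through its far
   `μ`-face, `‖R(x,μ)·conj T(x+e_μ)·T(x) − Rc(y,μ)‖ ≤ m`;
 * FED⁺ (`VariationalCovariantFederbush.sum_dirU_Qc_le`, P2 owner) binder `hmis`: `‖Rc(y,μ)·T(L(y+e_μ)+j) − T(Ly+j)·Π_L(Ly+j, μ)‖ ≤ m`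
   for EVERY offset `j` (`mis`, the straight fine holonomy of `L` steps against the coarse phase).
Here `Rc := coarseT R`, THE STRAIGHT COARSE TRANSPORT `coarseT R y μ := piT R (L·y) μ L` (`L` fine bonds from the block base point —
the abelian reading of the block field `U(Γ)` along straight contours, [Balaban1985BackgroundPropagators] (3.19) p.393 SHAPE only), and
both binders are DISCHARGED from the plaquette defect: with `w := (d−1)(L−1)·a` (the in-block constant),

  `hcross ≤ (L+1)·w`   (`cross_defect_taxiT_le`),     `hmis ≤ L·w`   (`norm_mis_taxiT_le`),

k-UNIFORM after the physical prefactors exactly like the in-block one (`a ≍ α(nL)⁻²` ⇒ `n·L·(L+1)·w ≍ d·α·L/n`).  THIS FILE is the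
MECHANISM (§1–§3); the two binders and the ENDS (ONE⁺ and FED⁺ for taxi data with the ONLY binders `|R| = 1`, `‖plaq R − 1‖ ≤ a`) are
the sequel `VariationalTaxiCoarseBinders` (`cross_defect_taxiT_le`, `norm_mis_taxiT_le`, `exists_oneStep_taxi`, `sum_dirU_Qc_taxi`).

THE MECHANISM ([folklore] abelian lattice Stokes).  §1 the RECTANGLE HOLONOMY `rect R p μ m ν ℓ = Π_{s<m}Π_{t<ℓ} plaq R (p+se_μ+te_ν) μ ν`
and the TWO-LEG COMMUTATION `piT R p μ m·piT R (p+me_μ) ν ℓ = rect·(piT R p ν ℓ·piT R (p+ℓe_ν) μ m)` (`piT_mul_piT_shift`, induction on `m`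
over the one-leg commutation `VariationalTaxiTransport.mul_piT_shift`), `‖rect − 1‖ ≤ mℓ·a`, and `rect R p μ m μ ℓ = 1` (collinear legs
commute exactly).  §2 the corners of the NEXT block: shifted by `L·e_μ` (all of them for the same digits; those before `μ` for the face
successor `update j μ 0`) or by `e_μ` (those after `μ`, face successor).  §3 two SWEEPS: the `L`-leg in direction `μ` from the base point
through the legs `i < k` (`lower_sweep`, rectangles `L × j_i`), and one `μ`-bond through the legs `i > μ` (`upper_sweep`, the in-block file's
holonomy `hol`).  §4 assembly: unit-modulus algebra, `‖uv − 1‖ ≤ ‖u − 1‖ + ‖v − 1‖`.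

HONEST FRAMING (T4-DAG p. 1).  A model-level DICTIONARY between hypothesis sets of OUR leaves (site/coarse transports as data ↦ bond phases as
data); [folklore]; nothing printed is a hypothesis; no `def … : Prop`; no `sorry`; axioms standard.  NOT the identification with Bałaban's
non-abelian `U(Γ)`, `Ū` (ordered products — same identities, not done); NOT NE2⁺; NE2 NOT proved; spine 0/9; rung (B)+1 finite T⁴ — NOT
infinite volume, NOT mass gap, NOT Clay.  HONEST DEPENDENCY (cell, verbatim): continuum YM on T⁴ ⇐ BetaPertH ∧ nine spine estimates (0/9
proved); BetaPertH ⇐ (D1) ∧ (D4) ∧ CAP+tail; G-an2-4 gates asym, D1 and NE2/3/4.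
-/

noncomputable section

open scoped BigOperators ComplexConjugate
open Finset

namespace Summit.QuantumFields.BalabanUV.T4Continuum.VariationalTaxiCoarse

open Literature.MathematicalPhysics.QuantumFieldTheory.Balaban1983to89.B5Prop11Plancherel (Tor fine unitVec)
open Literature.MathematicalPhysics.QuantumFieldTheory.Balaban1983to89.B5Block118 (tstep tstep_zero tstep_succ bpt bpt_add_tstep)
open Summit.QuantumFields.BalabanUV.T4Continuum.ScalarBlockTrialFunction (bpt_add_unitVec_of_eq)
open Summit.QuantumFields.BalabanUV.T4Continuum.VariationalCovariantFederbush (piT)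
open Summit.QuantumFields.BalabanUV.T4Continuum.VariationalCovariantUpperBound (mul_conj_of_norm_one)
open Summit.QuantumFields.BalabanUV.T4Continuum.VariationalTaxiTransport

variable {d : ℕ}

/-! ## §1 Rectangles: the two-leg commutation -/

section Rect

variable (L : ℕ) [NeZero L] (N : Fin d → ℕ) [hN : ∀ μ, NeZero (N μ)]

/-- the RECTANGLE HOLONOMY `rect R p μ m ν ℓ = Π_{s<m} Π_{t<ℓ} plaq R (p + s e_μ + t e_ν) μ ν`. [folklore] -/
def rect (R : Tor (fine L N) → Fin d → ℂ) (p : Tor (fine L N)) (μ : Fin d) (m : ℕ) (ν : Fin d) (ℓ : ℕ) : ℂ :=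
  ∏ s ∈ Finset.range m, ∏ t ∈ Finset.range ℓ, plaq L N R (p + tstep (fine L N) μ s + tstep (fine L N) ν t) μ ν

/-- the STRAIGHT COARSE TRANSPORT: `L` fine bonds from the block base point `L·y` in direction `μ`. [folklore] -/
def coarseT (R : Tor (fine L N) → Fin d → ℂ) (y : Tor N) (μ : Fin d) : ℂ := piT L N R (bpt L N y 0) μ L

omit [NeZero L] hN in
/-- one more row of the rectangle. [folklore] -/
theorem rect_succ (R : Tor (fine L N) → Fin d → ℂ) (p : Tor (fine L N)) (μ : Fin d) (m : ℕ) (ν : Fin d) (ℓ : ℕ) :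
    rect L N R p μ (m + 1) ν ℓ
      = rect L N R p μ m ν ℓ * ∏ t ∈ Finset.range ℓ, plaq L N R (p + tstep (fine L N) μ m + tstep (fine L N) ν t) μ ν := by
  unfold rect
  rw [Finset.prod_range_succ]

variable {R : Tor (fine L N) → Fin d → ℂ} (hR1 : ∀ x μ, ‖R x μ‖ = 1)
include hR1

omit [NeZero L] hN in
/-- degenerate plaquettes are trivial: `plaq R x μ μ = 1`. [folklore] -/
theorem plaq_self (x : Tor (fine L N)) (μ : Fin d) : plaq L N R x μ μ = 1 := by
  have h1 := (mul_conj_of_norm_one (hR1 (x + unitVec (fine L N) μ) μ)).1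
  have h2 := (mul_conj_of_norm_one (hR1 x μ)).1
  unfold plaq
  linear_combination (R x μ * conj (R x μ)) * h1 + h2

omit [NeZero L] hN in
/-- rectangles have norm `1`. [folklore] -/
theorem norm_rect (p : Tor (fine L N)) (μ : Fin d) (m : ℕ) (ν : Fin d) (ℓ : ℕ) : ‖rect L N R p μ m ν ℓ‖ = 1 :=
  norm_prod_eq_one _ _ fun _ _ => norm_prod_eq_one _ _ fun _ _ => norm_plaq L N hR1 _ _ _

omit [NeZero L] hN in
/-- collinear legs commute exactly: `rect R p μ m μ ℓ = 1`. [folklore] -/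
theorem rect_self (p : Tor (fine L N)) (μ : Fin d) (m ℓ : ℕ) : rect L N R p μ m μ ℓ = 1 :=
  Finset.prod_eq_one fun _ _ => Finset.prod_eq_one fun _ _ => plaq_self L N hR1 _ _

omit [NeZero L] hN in
/-- `‖rect − 1‖ ≤ m·ℓ·a` under the plaquette defect `a`. [folklore] -/
theorem norm_rect_sub_one_le (p : Tor (fine L N)) (μ : Fin d) (m : ℕ) (ν : Fin d) (ℓ : ℕ) {a : ℝ}
    (ha : ∀ x κ ι, ‖plaq L N R x κ ι - 1‖ ≤ a) : ‖rect L N R p μ m ν ℓ - 1‖ ≤ (m : ℝ) * ℓ * a := by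
  unfold rect
  refine (norm_prod_sub_one_le _ _ fun s _ => ?_).trans ?_
  · rw [norm_prod]; exact Finset.prod_le_one (fun _ _ => norm_nonneg _) fun t _ => (norm_plaq L N hR1 _ _ _).le
  · have hrow : ∀ s ∈ Finset.range m,
        ‖∏ t ∈ Finset.range ℓ, plaq L N R (p + tstep (fine L N) μ s + tstep (fine L N) ν t) μ ν - 1‖ ≤ (ℓ : ℝ) * a := by
      intro s _
      refine (norm_prod_sub_one_le _ _ fun t _ => (norm_plaq L N hR1 _ _ _).le).trans ?_
      refine (Finset.sum_le_sum fun t _ => ha _ _ _).trans ?_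
      rw [Finset.sum_const, Finset.card_range, nsmul_eq_mul]
    refine (Finset.sum_le_sum hrow).trans ?_
    rw [Finset.sum_const, Finset.card_range, nsmul_eq_mul, mul_assoc]

omit [NeZero L] hN in
/-- **TWO-LEG COMMUTATION** (rectangle Stokes): `piT R p μ m·piT R (p + m e_μ) ν ℓ = rect·(piT R p ν ℓ·piT R (p + ℓ e_ν) μ m)`. [folklore] -/
theorem piT_mul_piT_shift (p : Tor (fine L N)) (μ ν : Fin d) (m ℓ : ℕ) :
    piT L N R p μ m * piT L N R (p + tstep (fine L N) μ m) ν ℓ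
      = rect L N R p μ m ν ℓ * (piT L N R p ν ℓ * piT L N R (p + tstep (fine L N) ν ℓ) μ m) := by
  induction m with
  | zero => simp [rect, piT, tstep_zero]
  | succ m ih =>
    have hq : p + tstep (fine L N) μ (m + 1) = p + tstep (fine L N) μ m + unitVec (fine L N) μ := by rw [tstep_succ, add_assoc]
    have hc := mul_piT_shift L N hR1 (p + tstep (fine L N) μ m) μ ν ℓ
    have hcomm : p + tstep (fine L N) μ m + tstep (fine L N) ν ℓ = p + tstep (fine L N) ν ℓ + tstep (fine L N) μ m :=
      add_right_comm _ _ _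
    have hpi : piT L N R (p + tstep (fine L N) ν ℓ) μ (m + 1)
        = piT L N R (p + tstep (fine L N) ν ℓ) μ m * R (p + tstep (fine L N) ν ℓ + tstep (fine L N) μ m) μ := by
      simp only [piT]
    rw [rect_succ, hpi]
    calc piT L N R p μ (m + 1) * piT L N R (p + tstep (fine L N) μ (m + 1)) ν ℓ
        = piT L N R p μ m * (R (p + tstep (fine L N) μ m) μ * piT L N R (p + tstep (fine L N) μ m + unitVec (fine L N) μ) ν ℓ) := by
          rw [hq]; simp only [piT]; ring
      _ = (∏ t ∈ Finset.range ℓ, plaq L N R (p + tstep (fine L N) μ m + tstep (fine L N) ν t) μ ν)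
            * (piT L N R p μ m * piT L N R (p + tstep (fine L N) μ m) ν ℓ) * R (p + tstep (fine L N) μ m + tstep (fine L N) ν ℓ) μ := by
          rw [hc]; ring
      _ = (∏ t ∈ Finset.range ℓ, plaq L N R (p + tstep (fine L N) μ m + tstep (fine L N) ν t) μ ν)
            * (rect L N R p μ m ν ℓ * (piT L N R p ν ℓ * piT L N R (p + tstep (fine L N) ν ℓ) μ m))
            * R (p + tstep (fine L N) ν ℓ + tstep (fine L N) μ m) μ := by rw [ih, hcomm]
      _ = rect L N R p μ m ν ℓ * (∏ t ∈ Finset.range ℓ, plaq L N R (p + tstep (fine L N) μ m + tstep (fine L N) ν t) μ ν)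
            * (piT L N R p ν ℓ * (piT L N R (p + tstep (fine L N) ν ℓ) μ m * R (p + tstep (fine L N) ν ℓ + tstep (fine L N) μ m) μ)) := by
          ring

omit hN in
/-- `|coarseT| = 1`. [folklore] -/
theorem norm_coarseT (y : Tor N) (μ : Fin d) : ‖coarseT L N R y μ‖ = 1 := norm_piT L N hR1 _ _ _

end Rect

/-! ## §2 The corners of the next block -/

section Corners

variable (L : ℕ) [NeZero L] (N : Fin d → ℕ) [hN : ∀ μ, NeZero (N μ)]

omit hN in
/-- the path starts at the block base point. [folklore] -/
theorem corner_zero (y : Tor N) (j : Fin d → Fin L) : corner L N y j 0 = bpt L N y 0 := by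
  unfold corner
  congr 1

omit hN in
/-- same digits, next block: every corner is shifted by `L·e_μ`. [folklore] -/
theorem corner_next (y : Tor N) (j : Fin d → Fin L) (μ : Fin d) (i : ℕ) :
    corner L N (y + unitVec N μ) j i = corner L N y j i + tstep (fine L N) μ L := by
  rw [corner, corner, bpt_add_tstep]

omit hN in
/-- face successor `update j μ 0`, corners up to `μ`: shifted by `L·e_μ`. [folklore] -/
theorem corner_face_of_le (y : Tor N) (j : Fin d → Fin L) (μ : Fin d) {i : ℕ} (hi : i ≤ (μ : ℕ)) :
    corner L N (y + unitVec N μ) (Function.update j μ 0) i = corner L N y j i + tstep (fine L N) μ L := by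
  have hb : below L (Function.update j μ 0) i = below L j i := by
    funext κ
    simp only [below, Function.update_apply]
    by_cases hκ : κ = μ
    · have hlt : ¬ ((κ : ℕ) < i) := by subst hκ; omega
      simp [hlt]
    · simp [hκ]
  rw [corner, corner, hb, bpt_add_tstep]

omit hN in
/-- face successor `update j μ 0` of a far-face offset (`j_μ + 1 = L`), corners after `μ`: shifted by `e_μ`. [folklore] -/
theorem corner_face_of_lt (y : Tor N) (j : Fin d → Fin L) (μ : Fin d) (hμ : (j μ : ℕ) + 1 = L) {i : ℕ} (hi : (μ : ℕ) < i) :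
    corner L N (y + unitVec N μ) (Function.update j μ 0) i = corner L N y j i + unitVec (fine L N) μ := by
  have hb : below L (Function.update j μ 0) i = Function.update (below L j i) μ 0 := by
    funext κ
    simp only [below, Function.update_apply]
    by_cases hκ : κ = μ
    · subst hκ; simp [hi]
    · simp [hκ]
  have hμ' : ((below L j i) μ : ℕ) + 1 = L := by simp [below, hi, hμ]
  rw [corner, corner, hb, ← bpt_add_unitVec_of_eq L N y (below L j i) μ hμ']

omit hN in
/-- splitting a product over `range d` at `μ`. [folklore] -/
theorem prod_range_split (g : ℕ → ℂ) (μ : Fin d) :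
    ∏ i ∈ Finset.range d, g i = (∏ i ∈ Finset.range (μ : ℕ), g i) * g μ * ∏ i ∈ Finset.Ico ((μ : ℕ) + 1) d, g i := by
  have hμd : (μ : ℕ) < d := μ.is_lt
  rw [Finset.range_eq_Ico, ← Finset.prod_Ico_consecutive g (Nat.zero_le _) hμd.le, Finset.prod_eq_prod_Ico_succ_bot hμd,
    Finset.range_eq_Ico]
  ring

variable {R : Tor (fine L N) → Fin d → ℂ}

omit hN in
/-- next block, same digits: the legs start `L·e_μ` further. [folklore] -/
theorem leg_next (y : Tor N) (j : Fin d → Fin L) (μ : Fin d) {i : ℕ} (hid : i < d) :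
    leg L N R (y + unitVec N μ) j i = piT L N R (corner L N y j i + tstep (fine L N) μ L) ⟨i, hid⟩ (j ⟨i, hid⟩ : ℕ) := by
  simp only [leg, dif_pos hid, corner_next]

omit hN in
/-- face successor, legs before `μ`. [folklore] -/
theorem leg_face_lt (y : Tor N) (j : Fin d → Fin L) (μ : Fin d) {i : ℕ} (hi : i < (μ : ℕ)) :
    leg L N R (y + unitVec N μ) (Function.update j μ 0) i
      = piT L N R (corner L N y j i + tstep (fine L N) μ L) ⟨i, hi.trans μ.is_lt⟩ (j ⟨i, hi.trans μ.is_lt⟩ : ℕ) := by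
  have hid : i < d := hi.trans μ.is_lt
  have hne : (⟨i, hid⟩ : Fin d) ≠ μ := fun e => by have := congrArg Fin.val e; simp at this; omega
  simp only [leg, dif_pos hid, corner_face_of_le L N y j μ hi.le, Function.update_of_ne hne]

omit hN in
/-- face successor, the `μ`-leg is empty. [folklore] -/
theorem leg_face_eq (y : Tor N) (j : Fin d → Fin L) (μ : Fin d) : leg L N R (y + unitVec N μ) (Function.update j μ 0) μ = 1 := by
  simp [leg, piT]

omit hN in
/-- face successor of a far-face offset, legs after `μ`: start shifted by `e_μ`. [folklore] -/
theorem leg_face_gt (y : Tor N) (j : Fin d → Fin L) (μ : Fin d) (hμ : (j μ : ℕ) + 1 = L) {i : ℕ} (hi : (μ : ℕ) < i) (hid : i < d) :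
    leg L N R (y + unitVec N μ) (Function.update j μ 0) i
      = piT L N R (corner L N y j i + unitVec (fine L N) μ) ⟨i, hid⟩ (j ⟨i, hid⟩ : ℕ) := by
  have hne : (⟨i, hid⟩ : Fin d) ≠ μ := fun e => by have := congrArg Fin.val e; simp at this; omega
  simp only [leg, dif_pos hid, corner_face_of_lt L N y j μ hμ hi, Function.update_of_ne hne]

end Corners

/-! ## §3 The two sweeps -/

section Sweeps

variable (L : ℕ) [NeZero L] (N : Fin d → ℕ) [hN : ∀ μ, NeZero (N μ)]
variable {R : Tor (fine L N) → Fin d → ℂ} (hR1 : ∀ x μ, ‖R x μ‖ = 1)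
include hR1

omit hN in
/-- **LOWER SWEEP**: the `L`-leg in direction `μ` from the base point moves through the legs `i < k`, each crossing a rectangle `L × j_i`:
`Π_L(L·y, μ)·Π_{i<k} piT (corner_i + L e_μ) i j_i = (Π_{i<k} rect (corner_i) μ L i j_i)·((Π_{i<k} leg_i)·Π_L(corner_k, μ))`. [folklore] -/
theorem lower_sweep (y : Tor N) (j : Fin d → Fin L) (μ : Fin d) :
    ∀ k, k ≤ d →
      piT L N R (bpt L N y 0) μ L
          * ∏ i ∈ Finset.range k, (if h : i < d then piT L N R (corner L N y j i + tstep (fine L N) μ L) ⟨i, h⟩ (j ⟨i, h⟩ : ℕ) else 1)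
        = (∏ i ∈ Finset.range k, (if h : i < d then rect L N R (corner L N y j i) μ L ⟨i, h⟩ (j ⟨i, h⟩ : ℕ) else 1))
          * ((∏ i ∈ Finset.range k, leg L N R y j i) * piT L N R (corner L N y j k) μ L) := by
  intro k hk
  induction k with
  | zero => simp [corner_zero]
  | succ k ih =>
    have hkd : k < d := Nat.lt_of_succ_le hk
    rw [Finset.prod_range_succ, Finset.prod_range_succ, Finset.prod_range_succ, dif_pos hkd, dif_pos hkd, ← mul_assoc, ih hkd.le,
      show leg L N R y j k = piT L N R (corner L N y j k) ⟨k, hkd⟩ (j ⟨k, hkd⟩ : ℕ) by simp [leg, dif_pos hkd],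
      corner_succ L N y j hkd]
    have hc := piT_mul_piT_shift L N hR1 (corner L N y j k) μ ⟨k, hkd⟩ L (j ⟨k, hkd⟩ : ℕ)
    calc (∏ i ∈ Finset.range k, (if h : i < d then rect L N R (corner L N y j i) μ L ⟨i, h⟩ (j ⟨i, h⟩ : ℕ) else 1))
          * ((∏ i ∈ Finset.range k, leg L N R y j i) * piT L N R (corner L N y j k) μ L)
          * piT L N R (corner L N y j k + tstep (fine L N) μ L) ⟨k, hkd⟩ (j ⟨k, hkd⟩ : ℕ)
        = (∏ i ∈ Finset.range k, (if h : i < d then rect L N R (corner L N y j i) μ L ⟨i, h⟩ (j ⟨i, h⟩ : ℕ) else 1))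
          * (∏ i ∈ Finset.range k, leg L N R y j i)
          * (piT L N R (corner L N y j k) μ L * piT L N R (corner L N y j k + tstep (fine L N) μ L) ⟨k, hkd⟩ (j ⟨k, hkd⟩ : ℕ)) := by ring
      _ = _ := by rw [hc]; ring

omit hN in
/-- **UPPER SWEEP** (the in-block file's sweep, restated): one `μ`-bond moves through the legs `μ < i < k`, each crossing `j_i` plaquettes;
at `k = d` the holonomy is `VariationalTaxiTransport.hol`. [folklore] -/
theorem upper_sweep (y : Tor N) (j : Fin d → Fin L) (μ : Fin d) :
    ∀ k, (μ : ℕ) + 1 ≤ k → k ≤ d →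
      R (corner L N y j ((μ : ℕ) + 1)) μ
          * ∏ i ∈ Finset.Ico ((μ : ℕ) + 1) k, (if h : i < d then piT L N R (corner L N y j i + unitVec (fine L N) μ) ⟨i, h⟩ (j ⟨i, h⟩ : ℕ) else 1)
        = (∏ i ∈ Finset.Ico ((μ : ℕ) + 1) k,
            if h : i < d then ∏ t ∈ Finset.range (j ⟨i, h⟩ : ℕ), plaq L N R (corner L N y j i + tstep (fine L N) ⟨i, h⟩ t) μ ⟨i, h⟩
            else 1)
          * ((∏ i ∈ Finset.Ico ((μ : ℕ) + 1) k, leg L N R y j i) * R (corner L N y j k) μ) := by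
  intro k hk hkd
  induction k, hk using Nat.le_induction with
  | base => simp
  | succ k hk ih =>
    have hkd' : k < d := Nat.lt_of_succ_le hkd
    rw [Finset.prod_Ico_succ_top hk, Finset.prod_Ico_succ_top hk, Finset.prod_Ico_succ_top hk, dif_pos hkd', dif_pos hkd', ← mul_assoc,
      ih hkd'.le, show leg L N R y j k = piT L N R (corner L N y j k) ⟨k, hkd'⟩ (j ⟨k, hkd'⟩ : ℕ) by simp [leg, dif_pos hkd'],
      corner_succ L N y j hkd']
    have hc := mul_piT_shift L N hR1 (corner L N y j k) μ ⟨k, hkd'⟩ (j ⟨k, hkd'⟩ : ℕ)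
    calc (∏ i ∈ Finset.Ico ((μ : ℕ) + 1) k, if h : i < d then
            ∏ t ∈ Finset.range (j ⟨i, h⟩ : ℕ), plaq L N R (corner L N y j i + tstep (fine L N) ⟨i, h⟩ t) μ ⟨i, h⟩ else 1)
          * ((∏ i ∈ Finset.Ico ((μ : ℕ) + 1) k, leg L N R y j i) * R (corner L N y j k) μ)
          * piT L N R (corner L N y j k + unitVec (fine L N) μ) ⟨k, hkd'⟩ (j ⟨k, hkd'⟩ : ℕ)
        = (∏ i ∈ Finset.Ico ((μ : ℕ) + 1) k, if h : i < d then
            ∏ t ∈ Finset.range (j ⟨i, h⟩ : ℕ), plaq L N R (corner L N y j i + tstep (fine L N) ⟨i, h⟩ t) μ ⟨i, h⟩ else 1)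
          * (∏ i ∈ Finset.Ico ((μ : ℕ) + 1) k, leg L N R y j i)
          * (R (corner L N y j k) μ * piT L N R (corner L N y j k + unitVec (fine L N) μ) ⟨k, hkd'⟩ (j ⟨k, hkd'⟩ : ℕ)) := by ring
      _ = _ := by rw [hc]; ring

omit hN in
/-- the lower holonomy is within `L·Σ_{i<k, i≠μ} j_i·a ≤ (d−1)·L·(L−1)·a` of `1` (the `μ`-th rectangle is degenerate). [folklore] -/
theorem norm_lowerHol_sub_one_le (y : Tor N) (j : Fin d → Fin L) (μ : Fin d) {a : ℝ} (ha : ∀ x κ ν, ‖plaq L N R x κ ν - 1‖ ≤ a)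
    {k : ℕ} (hk : k ≤ d) :
    ‖(∏ i ∈ Finset.range k, (if h : i < d then rect L N R (corner L N y j i) μ L ⟨i, h⟩ (j ⟨i, h⟩ : ℕ) else 1)) - 1‖
      ≤ ((d - 1 : ℕ) : ℝ) * ((L : ℝ) * ((L - 1 : ℕ) : ℝ) * a) := by
  have ha0 : 0 ≤ a := (norm_nonneg _).trans (ha (corner L N y j 0) μ μ)
  have hB0 : 0 ≤ (L : ℝ) * ((L - 1 : ℕ) : ℝ) * a := by positivity
  set f : ℕ → ℝ := fun i =>
    ‖(if h : i < d then rect L N R (corner L N y j i) μ L ⟨i, h⟩ (j ⟨i, h⟩ : ℕ) else 1) - 1‖ with hf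
  have hfμ : f μ = 0 := by
    simp only [hf, dif_pos μ.is_lt, Fin.eta, rect_self L N hR1, sub_self, norm_zero]
  have hfle : ∀ i ∈ (Finset.range k).erase (μ : ℕ), f i ≤ (L : ℝ) * ((L - 1 : ℕ) : ℝ) * a := by
    intro i hi
    have hid : i < d := lt_of_lt_of_le (Finset.mem_range.mp (Finset.mem_of_mem_erase hi)) hk
    simp only [hf, dif_pos hid]
    refine (norm_rect_sub_one_le L N hR1 _ _ _ _ _ ha).trans ?_
    have hj : ((j ⟨i, hid⟩ : ℕ) : ℝ) ≤ ((L - 1 : ℕ) : ℝ) := by exact_mod_cast Nat.le_sub_one_of_lt (j ⟨i, hid⟩).is_lt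
    exact mul_le_mul_of_nonneg_right (mul_le_mul_of_nonneg_left hj (Nat.cast_nonneg _)) ha0
  refine (norm_prod_sub_one_le _ _ fun i _ => ?_).trans ?_
  · split_ifs with h
    · exact (norm_rect L N hR1 _ _ _ _ _).le
    · simp
  · change ∑ i ∈ Finset.range k, f i ≤ _
    rw [← Finset.sum_erase (Finset.range k) hfμ]
    refine (Finset.sum_le_sum hfle).trans ?_
    rw [Finset.sum_const, nsmul_eq_mul]
    refine mul_le_mul_of_nonneg_right ?_ hB0
    have hcard : ((Finset.range k).erase (μ : ℕ)).card ≤ d - 1 := by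
      by_cases hμk : (μ : ℕ) ∈ Finset.range k
      · rw [Finset.card_erase_of_mem hμk, Finset.card_range]; omega
      · rw [Finset.erase_eq_of_notMem hμk, Finset.card_range]
        have := μ.is_lt; simp only [Finset.mem_range, not_lt] at hμk; omega
    exact_mod_cast hcard

end Sweeps

end Summit.QuantumFields.BalabanUV.T4Continuum.VariationalTaxiCoarse

end
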